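import Summits.MatrixMultiplication.MatrixMultiplication.Theorems.FarEdgeDescentNearVertex
import Summits.MatrixMultiplication.MatrixMultiplication.Theorems.FarEdgeDescentTailShadow
import Literature.Computability.AlgebraicComplexity.Coppersmith1982RapidRectangular
import HarnessLib

/-!
# Route `FarEdgeDescent` — THE ANCHOR LAW: why the generic leaf sits at the square, and nowhere else
(lens-2 «special vs generic», gen 42; support module for the crux `AnchoredLogConvexity`
stmt-MatrixMultiplication-28900; def-free; the cut of record `closes (h₁ : FiniteSaturation) (h₂ :
AnchoredLogConvexity)` is UNCHANGED)

Write `e(x) := ω(1,x,1) − (x+1)` (tree `omegaRect ℂ 1 x 1 - (x + 1)`) for the excess of the pencil `⟨n, n^x, n⟩`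
and consider the ONE-PARAMETER FAMILY OF ANCHORED LAWS (always spelled inline below)

  `L(a) :  ∀ m > a,  e(m)² ≤ e(a) · e(2m − a)`     — log-convexity of `e` across the three points `a, m, 2m − a`.

`L(1)` is the generic crux `AnchoredLogConvexity` word for word (`anchoredLaw_one_iff`); `L(a)` is the `2 × 2`
minor `det [[e(a), e(m)], [e(m), e(2m−a)]] ≥ 0` of the Hankel kernel `(x,y) ↦ e(x+y−1)` at the nodes
`(a+1)/2, (2m−a+1)/2`.  This file decides the status of `L(a)` at EVERY anchor and shows that the square is
selected by the dichotomy itself: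

* §1 NEAR CLASS `a < α` (the dual exponent; in particular every `a ≤ 0.1722` at kernel grade, by the tree's
  Coppersmith theorem `coppersmith1982_dualExponentAlpha_gt`): `L(a)` is FALSE (`anchoredLaw_false_of_lt_alpha`).
  On the Coppersmith plateau the profile is `2`, the excess is the affine `1 − x`, and an affine function is
  STRICTLY log-concave across any three points in arithmetic progression (AM–GM gap `(α − a)²/4`).  Hence also:
  the anchor binder `1 ≤ k − h` of the aside `RealLogConvexity` (28902) cannot be relaxed below `α`
  (`realLogConvexity_false_below_alpha`, `realLogConvexity_false_without_anchor`): any proof of 28900/28902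
  must use the anchor — it cannot be a property of the whole pencil `[0,∞)`.
* §2 SUB-SQUARE CLASS `a < 1`: what the SPECIAL leaf does to ANY anchored law is saturation at the anchor,
  `FiniteSaturation ∧ L(a) ⟹ ω(1,a,1) = a + 1` for every real `a` (`saturated_anchor_of_finiteSaturation`:
  halving orbit `a + (K−a)/2ⁿ → a⁺` plus monotonicity; no continuity, no `a ≥ 1`).  Below the square this
  contradicts flattening `ω(1,a,1) ≥ 2`: **`FiniteSaturation ⟹ ¬ L(a)` for all `a < 1`**
  (`not_anchoredLaw_of_finiteSaturation`) — the special leaf ALONE refutes every sub-square anchoring of the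
  generic one, so a cut `FiniteSaturation ∧ L(a)`, `a < 1`, is inconsistent; a fortiori `ω = 2 ⟹ ¬ L(a)`
  (`not_anchoredLaw_of_mm`, ANTI-necessity: a sub-square law would DISPROVE the summit, `not_mm_of_anchoredLaw`),
  while `L(a)`, `a ≥ 1`, IS necessary (`anchoredLaw_of_mm`); under the summit the law holds EXACTLY at the
  anchors `a ≥ 1` (`anchoredLaw_iff_one_le_of_mm`) — the square is the LEAST consistent anchor.
* §3 FAR CLASS `a ≥ 1`: `RealLogConvexity ⟹ L(a)` (`anchoredLaw_of_realLogConvexity`).  At `a = 1` saturation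
  at the anchor is `ω = 2` (`closes_via_anchor`, the route's `closes` recovered); at every `a > 1` it is NOT
  the summit: `anchoredLaw_insufficient_of_one_lt` builds, through the landed far-tail freedom theorem
  `FarEdgeDescentTailShadow.farTail_realisable`, a 3D-LAWFUL functional (symmetric, homogeneous, subadditive,
  monotone, sandwiched) with far excess `(a − x)₊/(a+2)` in which `FiniteSaturation`-shape and `L(a)`-shape hold
  and `W(1,1,1) = 2 + (a−1)/(a+2) > 2`.

ANCHOR TRICHOTOMY (lens reading «special vs generic» on the anchor axis): `a < 1` — refuted by the SPECIAL
side (outright on the Coppersmith plateau `a < α`; by the special leaf `FiniteSaturation` everywhere below the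
square); `a = 1` — necessary AND, with the special leaf, sufficient; `a > 1` — necessary, insufficient (lawful
world).  The generic leaf of the cut is therefore pinned: `AnchoredLogConvexity = L(1)` is the unique member of
its family that can serve next to `FiniteSaturation`.  The companion `FarEdgeDescentLaplaceLaw` gives the umbrella under which all
smooth model worlds of the lineage satisfy every `L(a)`, `a ≥ 1`, at once (Laplace law ⟹ exponential
convexity of all Hankel orders).  Nothing here proves `ω = 2`; no tensor mechanism for any `L(a)`, `a ≥ 1`, is
known (leaf tag IDEA-NEEDED unchanged).
[cite: Coppersmith1982, Theorem] [cite: BurgisserClausenShokrollahi1997, Thm. (15.51), Cor. (15.18)]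
[cite: LottiRomani1983, §2 (p. 174)] [cite: HuangPan1998, §2 eq. (2.5)–(2.8)] [cite: Widder1941, Ch. IV §§12–13
(log-convexity of Laplace transforms; Bernstein), Thm. IV.21 (exponential convexity)]
-/

set_option linter.dupNamespace false

noncomputable section

namespace Summit.MatrixMultiplication.MatrixMultiplication.Theorems.FarEdgeDescentAnchorLaw

open Literature.Computability.AlgebraicComplexity Set
open Summit.MatrixMultiplication.MatrixMultiplication.Theses.FarEdgeDescent
open Summit.MatrixMultiplication.MatrixMultiplication.Theorems.FarEdgeDescentChord
open Summit.MatrixMultiplication.MatrixMultiplication.Theorems.FarEdgeDescentNearVertex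
open Summit.MatrixMultiplication.MatrixMultiplication.Theorems.FarEdgeDescentTailShadow

/-! ## §0 The algebra of the plateau: affine is strictly log-concave -/

/-- AM–GM with its gap: `A·B < ((A+B)/2)²` unless `A = B` (the gap is `(A−B)²/4`). -/
theorem mul_lt_sq_midpoint {A B : ℝ} (h : A ≠ B) : A * B < ((A + B) / 2) ^ 2 := by
  have h' : A - B ≠ 0 := sub_ne_zero.mpr h
  have h2 : 0 < (A - B) ^ 2 := by positivity
  nlinarith [h2]

/-- **On the Coppersmith plateau the excess is strictly log-concave.**  For `x, z ≤ α`, `x ≠ z`, the profile is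
`2` at `x`, `z` and `(x+z)/2` (tree `profile_eq_two_of_le_alpha`), the excess there is `1 − ·`, and
`e(x)·e(z) < e((x+z)/2)²`. -/
theorem excess_mul_lt_sq_of_le_alpha {x z : ℝ} (hx : x ≤ dualExponentAlpha ℂ) (hz : z ≤ dualExponentAlpha ℂ)
    (hxz : x ≠ z) :
    (omegaRect ℂ 1 x 1 - (x + 1)) * (omegaRect ℂ 1 z 1 - (z + 1)) <
      (omegaRect ℂ 1 ((x + z) / 2) 1 - ((x + z) / 2 + 1)) ^ 2 := by
  have hm : (x + z) / 2 ≤ dualExponentAlpha ℂ := by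
    rcases le_total x z with h | h <;> linarith
  rw [profile_eq_two_of_le_alpha hx, profile_eq_two_of_le_alpha hz, profile_eq_two_of_le_alpha hm]
  have h := mul_lt_sq_midpoint (A := 1 - x) (B := 1 - z) (fun h => hxz (by linarith))
  convert h using 1 <;> ring

/-! ## §1 The near class: the anchored law is FALSE below the dual exponent -/

/-- **`L(a)` is false for every anchor `a < α`.**  Witness `m = (a + α)/2` (so `2m − a = α`): all three points
lie on the plateau and `e(a)·e(α) < e(m)²` by the AM–GM gap `(α − a)²/4 > 0`. -/
theorem anchoredLaw_false_of_lt_alpha {a : ℝ} (ha : a < dualExponentAlpha ℂ) :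
    ¬ ∀ m : ℝ, a < m → (omegaRect ℂ 1 m 1 - (m + 1)) ^ 2 ≤
        (omegaRect ℂ 1 a 1 - (a + 1)) * (omegaRect ℂ 1 (2 * m - a) 1 - (2 * m - a + 1)) := by
  intro h
  have hlt := excess_mul_lt_sq_of_le_alpha ha.le le_rfl ha.ne
  have h' := h ((a + dualExponentAlpha ℂ) / 2) (by linarith)
  have e : 2 * ((a + dualExponentAlpha ℂ) / 2) - a = dualExponentAlpha ℂ := by ring
  rw [e] at h'
  exact absurd h' (not_le.mpr hlt)

/-- Kernel-grade numeric instance (the tree's Coppersmith theorem `α > 0.1722`, every field): **every anchor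
`a ≤ 0.1722` carries a false law** — unconditionally, no table fact assumed.
[cite: Coppersmith1982, Theorem] [cite: BurgisserClausenShokrollahi1997, Thm. (15.51), Cor. (15.18)] -/
theorem anchoredLaw_false_of_le_coppersmith {a : ℝ} (ha : a ≤ 0.1722) :
    ¬ ∀ m : ℝ, a < m → (omegaRect ℂ 1 m 1 - (m + 1)) ^ 2 ≤
        (omegaRect ℂ 1 a 1 - (a + 1)) * (omegaRect ℂ 1 (2 * m - a) 1 - (2 * m - a + 1)) :=
  anchoredLaw_false_of_lt_alpha (ha.trans_lt (coppersmith1982_dualExponentAlpha_gt ℂ))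

/-- **At the near vertex** (`ω(1,0,1) = 2`, `e(0) = 1`): `¬ ∀ m > 0, e(m)² ≤ e(2m)` — the law anchored at the
other end of the Lotti–Romani segment is false. -/
theorem anchoredLaw_false_at_zero :
    ¬ ∀ m : ℝ, 0 < m → (omegaRect ℂ 1 m 1 - (m + 1)) ^ 2 ≤ omegaRect ℂ 1 (2 * m) 1 - (2 * m + 1) := by
  intro h
  refine anchoredLaw_false_of_le_coppersmith (a := 0) (by norm_num) fun m hm => ?_
  have e1 : omegaRect ℂ 1 0 1 - (0 + 1) = 1 := by rw [omegaRect_one_zero_one]; norm_num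
  rw [e1, one_mul, sub_zero]
  exact h m hm

/-- **`RealLogConvexity` is FALSE below the dual exponent.**  The aside 28902 reads `∀ k h, 0 < h → 1 ≤ k − h →
e(k)² ≤ e(k−h)·e(k+h)`; with the anchor binder relaxed to `t ≤ k − h` for ANY `t < α` the statement is false
(centre `(t+α)/2`, half-width `(α−t)/2`). -/
theorem realLogConvexity_false_below_alpha {t : ℝ} (ht : t < dualExponentAlpha ℂ) :
    ¬ ∀ k h : ℝ, 0 < h → t ≤ k - h → (omegaRect ℂ 1 k 1 - (k + 1)) ^ 2 ≤
        (omegaRect ℂ 1 (k - h) 1 - (k - h + 1)) * (omegaRect ℂ 1 (k + h) 1 - (k + h + 1)) := by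
  intro H
  have hlt := excess_mul_lt_sq_of_le_alpha (x := t) (z := dualExponentAlpha ℂ) ht.le le_rfl ht.ne
  have h' := H ((t + dualExponentAlpha ℂ) / 2) ((dualExponentAlpha ℂ - t) / 2) (by linarith) (by linarith)
  have e1 : (t + dualExponentAlpha ℂ) / 2 - (dualExponentAlpha ℂ - t) / 2 = t := by ring
  have e2 : (t + dualExponentAlpha ℂ) / 2 + (dualExponentAlpha ℂ - t) / 2 = dualExponentAlpha ℂ := by ring
  rw [e1, e2] at h'
  exact absurd h' (not_le.mpr hlt)

/-- **`RealLogConvexity` is FALSE WITHOUT ITS ANCHOR** (`_false_without_` form for 28902 and, through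
`anchoredLaw_one_iff`/`anchoredLaw_of_realLogConvexity`, for the generic crux 28900): with `1 ≤ k − h`
weakened to `0 ≤ k − h` the law fails on the plateau.  Unconditional (Coppersmith). -/
theorem realLogConvexity_false_without_anchor :
    ¬ ∀ k h : ℝ, 0 < h → 0 ≤ k - h → (omegaRect ℂ 1 k 1 - (k + 1)) ^ 2 ≤
        (omegaRect ℂ 1 (k - h) 1 - (k - h + 1)) * (omegaRect ℂ 1 (k + h) 1 - (k + h + 1)) :=
  realLogConvexity_false_below_alpha
    ((by norm_num : (0 : ℝ) < 0.1722).trans (coppersmith1982_dualExponentAlpha_gt ℂ))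

/-! ## §2 The sub-square class: the SPECIAL LEAF refutes every law anchored below the square -/

/-- **What the special leaf does to an anchored law: SATURATION AT THE ANCHOR — at ANY anchor `a : ℝ`.**
If `e(K) = 0` at an integer `K` then either `K ≤ a` (the excess is antitone) or the halving orbit
`a + (K − a)/2ⁿ` is saturated by `L(a)` (`e(mid)² ≤ e(a)·e(orbit point) = 0`) and monotonicity of the profile
gives `0 ≤ e(a) ≤ (K−a)/2ⁿ` for every `n`.  No continuity, no `a ≥ 1`. -/
theorem saturated_anchor_of_finiteSaturation {a : ℝ} (hF : FiniteSaturation)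
    (hL : ∀ m : ℝ, a < m → (omegaRect ℂ 1 m 1 - (m + 1)) ^ 2 ≤
        (omegaRect ℂ 1 a 1 - (a + 1)) * (omegaRect ℂ 1 (2 * m - a) 1 - (2 * m - a + 1))) :
    omegaRect ℂ 1 a 1 = a + 1 := by
  obtain ⟨K, -, hK⟩ := hF
  have hnn := add_one_le_omegaRect_one_mid_one ℂ a
  rcases le_or_gt (K : ℝ) a with hKa | haK
  · have h := excess_antitone (x := a) (y := K) hKa
    rw [hK] at h
    linarith
  · have orbit : ∀ n : ℕ,
        omegaRect ℂ 1 (a + ((K : ℝ) - a) / 2 ^ n) 1 = (a + ((K : ℝ) - a) / 2 ^ n) + 1 := by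
      intro n
      induction n with
      | zero =>
        have e : a + ((K : ℝ) - a) / 2 ^ 0 = K := by rw [pow_zero, div_one]; ring
        rw [e]; exact hK
      | succ n ih =>
        have hpos : 0 < ((K : ℝ) - a) / 2 ^ (n + 1) := div_pos (by linarith) (pow_pos two_pos _)
        have h := hL (a + ((K : ℝ) - a) / 2 ^ (n + 1)) (by linarith)
        have e1 : 2 * (a + ((K : ℝ) - a) / 2 ^ (n + 1)) - a = a + ((K : ℝ) - a) / 2 ^ n := by
          rw [pow_succ]; field_simp; ring
        rw [e1, ih] at h
        have e2 : a + ((K : ℝ) - a) / 2 ^ n + 1 - (a + ((K : ℝ) - a) / 2 ^ n + 1) = 0 := by ring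
        rw [e2, mul_zero] at h
        have hsq := le_antisymm h (sq_nonneg _)
        have hlin := (pow_eq_zero_iff two_ne_zero).1 hsq
        linarith
    have hle : ∀ n : ℕ, omegaRect ℂ 1 a 1 - (a + 1) ≤ ((K : ℝ) - a) / 2 ^ n := by
      intro n
      have hpos : 0 ≤ ((K : ℝ) - a) / 2 ^ n := (div_pos (by linarith) (pow_pos two_pos n)).le
      have hmono := omegaRect_one_mid_one_mono ℂ (p := a) (q := a + ((K : ℝ) - a) / 2 ^ n) (by linarith)
      rw [orbit n] at hmono
      linarith
    have hzero : omegaRect ℂ 1 a 1 - (a + 1) ≤ 0 := by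
      by_contra hpos
      rw [not_le] at hpos
      have hKa : (0 : ℝ) < K - a := by linarith
      obtain ⟨n, hn⟩ := exists_pow_lt_of_lt_one (div_pos hpos hKa) (by norm_num : (1 / 2 : ℝ) < 1)
      rw [lt_div_iff₀ hKa] at hn
      have e : ((K : ℝ) - a) / 2 ^ n = (1 / 2) ^ n * ((K : ℝ) - a) := by
        rw [one_div_pow, mul_comm, ← div_eq_mul_one_div]
      have h := hle n
      rw [e] at h
      linarith
    linarith


/-- **The special leaf refutes every sub-square anchored law**: `FiniteSaturation ⟹ ¬ L(a)` for all `a < 1`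
(saturation at the anchor would give `ω(1,a,1) = a + 1 < 2`, against flattening `ω(1,a,1) ≥ 2`).  So the two
leaves of a cut `FiniteSaturation ∧ L(a)` are jointly INCONSISTENT unless `a ≥ 1`: the special leaf itself
forces the generic leaf's anchor up to the square. -/
theorem not_anchoredLaw_of_finiteSaturation {a : ℝ} (ha : a < 1) (hF : FiniteSaturation) :
    ¬ ∀ m : ℝ, a < m → (omegaRect ℂ 1 m 1 - (m + 1)) ^ 2 ≤
        (omegaRect ℂ 1 a 1 - (a + 1)) * (omegaRect ℂ 1 (2 * m - a) 1 - (2 * m - a + 1)) := by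
  intro hL
  have h := saturated_anchor_of_finiteSaturation hF hL
  have h2 := two_le_omegaRect_one_mid_one ℂ a
  linarith

/-- Contrapositive: a sub-square anchored law REFUTES THE SPECIAL LEAF. -/
theorem not_finiteSaturation_of_anchoredLaw {a : ℝ} (ha : a < 1)
    (hL : ∀ m : ℝ, a < m → (omegaRect ℂ 1 m 1 - (m + 1)) ^ 2 ≤
        (omegaRect ℂ 1 a 1 - (a + 1)) * (omegaRect ℂ 1 (2 * m - a) 1 - (2 * m - a + 1))) :
    ¬ FiniteSaturation :=
  fun hF => not_anchoredLaw_of_finiteSaturation ha hF hL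

/-- **Anti-necessity below the square**: `ω = 2 ⟹ ¬ L(a)` for every `a < 1` (through the special leaf,
`finiteSaturation_of_mm`; equivalently: under `ω = 2` the dual exponent is `1`, so every sub-square anchor is in
the near class of §1). -/
theorem not_anchoredLaw_of_mm {a : ℝ} (ha : a < 1) (hS : _root_.MatrixMultiplication) :
    ¬ ∀ m : ℝ, a < m → (omegaRect ℂ 1 m 1 - (m + 1)) ^ 2 ≤
        (omegaRect ℂ 1 a 1 - (a + 1)) * (omegaRect ℂ 1 (2 * m - a) 1 - (2 * m - a + 1)) :=
  not_anchoredLaw_of_finiteSaturation ha (finiteSaturation_of_mm hS)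

/-- Contrapositive: **a log-convexity law for the excess anchored ANYWHERE BELOW THE SQUARE disproves
`ω = 2`.**  (So `L(a)`, `α ≤ a < 1`, is a typed negative-side statement, not a candidate leaf.) -/
theorem not_mm_of_anchoredLaw {a : ℝ} (ha : a < 1)
    (hL : ∀ m : ℝ, a < m → (omegaRect ℂ 1 m 1 - (m + 1)) ^ 2 ≤
        (omegaRect ℂ 1 a 1 - (a + 1)) * (omegaRect ℂ 1 (2 * m - a) 1 - (2 * m - a + 1))) :
    ¬ _root_.MatrixMultiplication :=
  fun hS => not_anchoredLaw_of_mm ha hS hL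

/-- **Necessity at and beyond the square**: `ω = 2 ⟹ L(a)` for every `a ≥ 1` (all three excesses vanish,
Huang–Pan sandwich `saturated_of_omega_eq_two`). -/
theorem anchoredLaw_of_mm {a : ℝ} (ha : 1 ≤ a) (hS : _root_.MatrixMultiplication) :
    ∀ m : ℝ, a < m → (omegaRect ℂ 1 m 1 - (m + 1)) ^ 2 ≤
        (omegaRect ℂ 1 a 1 - (a + 1)) * (omegaRect ℂ 1 (2 * m - a) 1 - (2 * m - a + 1)) := by
  rw [_root_.MatrixMultiplication_iff] at hS
  intro m hm
  rw [saturated_of_omega_eq_two hS (x := m) (by linarith), saturated_of_omega_eq_two hS (x := a) ha,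
    saturated_of_omega_eq_two hS (x := 2 * m - a) (by linarith)]
  simp

/-- **Under the summit the anchored law holds EXACTLY at the anchors `a ≥ 1`** — the square is the least
`S`-consistent anchor of the family. -/
theorem anchoredLaw_iff_one_le_of_mm (hS : _root_.MatrixMultiplication) (a : ℝ) :
    (∀ m : ℝ, a < m → (omegaRect ℂ 1 m 1 - (m + 1)) ^ 2 ≤
        (omegaRect ℂ 1 a 1 - (a + 1)) * (omegaRect ℂ 1 (2 * m - a) 1 - (2 * m - a + 1))) ↔ 1 ≤ a :=
  ⟨fun hL => by
    by_contra h
    exact not_anchoredLaw_of_mm (not_le.mp h) hS hL, fun ha => anchoredLaw_of_mm ha hS⟩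

/-- `L(1)` is the generic crux `AnchoredLogConvexity` (stmt-MatrixMultiplication-28900) verbatim. -/
theorem anchoredLaw_one_iff :
    (∀ m : ℝ, 1 < m → (omegaRect ℂ 1 m 1 - (m + 1)) ^ 2 ≤
        (omegaRect ℂ 1 1 1 - (1 + 1)) * (omegaRect ℂ 1 (2 * m - 1) 1 - (2 * m - 1 + 1))) ↔
      AnchoredLogConvexity := by
  refine forall_congr' fun m => forall_congr' fun _ => ?_
  rw [show ((1 : ℝ) + 1) = 2 by norm_num, show (2 * m - 1 + 1 : ℝ) = 2 * m by ring]

/-! ## §3 The far class: necessary at every `a ≥ 1`, sufficient (with the special leaf) only at `a = 1` -/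

/-- `RealLogConvexity` (28902) implies every far-anchored law `L(a)`, `a ≥ 1` (centre `m`, half-width `m − a`;
the binder `1 ≤ k − h` is exactly `1 ≤ a`). -/
theorem anchoredLaw_of_realLogConvexity {a : ℝ} (ha : 1 ≤ a) (h : RealLogConvexity) :
    ∀ m : ℝ, a < m → (omegaRect ℂ 1 m 1 - (m + 1)) ^ 2 ≤
        (omegaRect ℂ 1 a 1 - (a + 1)) * (omegaRect ℂ 1 (2 * m - a) 1 - (2 * m - a + 1)) := by
  intro m hm
  have h' := h m (m - a) (by linarith) (by linarith)
  have e1 : m - (m - a) = a := by ring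
  have e2 : m + (m - a) = 2 * m - a := by ring
  rw [e1, e2] at h'
  exact h'

/-- **At the square this is the summit**: `FiniteSaturation ∧ L(1) ⟹ ω = 2` (the route's `closes`, recovered
through the anchor: `ω(1,1,1) = 2`). -/
theorem closes_via_anchor (hF : FiniteSaturation)
    (hL : ∀ m : ℝ, 1 < m → (omegaRect ℂ 1 m 1 - (m + 1)) ^ 2 ≤
        (omegaRect ℂ 1 1 1 - (1 + 1)) * (omegaRect ℂ 1 (2 * m - 1) 1 - (2 * m - 1 + 1))) :
    _root_.MatrixMultiplication := by
  rw [_root_.MatrixMultiplication_iff, ← omegaRect_one_one_one]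
  have h := saturated_anchor_of_finiteSaturation hF hL
  rw [h]; norm_num

/-- **Beyond the square the law is INSUFFICIENT — in a lawful world.**  For every `a > 1` there is a
3D-LAWFUL functional `W` (symmetric, positively homogeneous, subadditive, monotone in the middle argument,
sandwiched between `max(a+c, a+b, b+c)` and `a+b+c` — the laws `ω(·,·,·)` is known to obey) whose pencil has
far excess `(a − x)₊/(a+2)`: `FiniteSaturation`-shape and `L(a)`-shape hold for `W`, yet `W(1,1,1) > 2`.
Built from the landed far-tail freedom theorem `farTail_realisable` (gen 27). -/
theorem anchoredLaw_insufficient_of_one_lt {a : ℝ} (ha : 1 < a) :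
    ∃ W : ℝ → ℝ → ℝ → ℝ,
      ((∀ x y z : ℝ, W x y z = W y x z ∧ W x y z = W x z y) ∧
        (∀ ν : ℝ, 0 < ν → ∀ x y z : ℝ, 0 < x → 0 < y → 0 < z →
          W (ν * x) (ν * y) (ν * z) = ν * W x y z) ∧
        (∀ x y z x' y' z' : ℝ, 0 < x → 0 < y → 0 < z → 0 < x' → 0 < y' → 0 < z' →
          W (x + x') (y + y') (z + z') ≤ W x y z + W x' y' z') ∧
        (∀ x y y' z : ℝ, 0 < x → 0 < y → y ≤ y' → 0 < z → W x y z ≤ W x y' z) ∧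
        (∀ x y z : ℝ, 0 < x → 0 < y → 0 < z →
          max (x + z) (max (x + y) (y + z)) ≤ W x y z ∧ W x y z ≤ x + y + z)) ∧
      (∃ K : ℕ, 2 ≤ K ∧ W 1 K 1 = K + 1) ∧
      (∀ m : ℝ, a < m → (W 1 m 1 - (m + 1)) ^ 2 ≤ (W 1 a 1 - (a + 1)) * (W 1 (2 * m - a) 1 - (2 * m - a + 1))) ∧
      2 < W 1 1 1 := by
  set c : ℝ := (a + 2)⁻¹ with hc_def
  have hc : 0 < c := by rw [hc_def]; positivity
  have hc1 : c * (a + 2) = 1 := by rw [hc_def]; exact inv_mul_cancel₀ (by linarith)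
  set g : ℝ → ℝ := fun x => c • max (a - x) 0 with hg_def
  have hg : ∀ x, g x = c * max (a - x) 0 := fun x => by simp [hg_def, smul_eq_mul]
  have hconv : ConvexOn ℝ (Ici 1) g := by
    have h1 : ConvexOn ℝ (Ici (1 : ℝ)) (fun x : ℝ => a - x) :=
      (convexOn_const (𝕜 := ℝ) a (convex_Ici (1 : ℝ))).sub (concaveOn_id (convex_Ici (1 : ℝ)))
    have h2 : ConvexOn ℝ (Ici (1 : ℝ)) (fun x : ℝ => max (a - x) 0) :=
      h1.sup (convexOn_const (𝕜 := ℝ) (0 : ℝ) (convex_Ici (1 : ℝ)))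
    have h3 : ConvexOn ℝ (Ici (1 : ℝ)) (fun x : ℝ => c • max (a - x) 0) := h2.smul hc.le
    rw [hg_def]; exact h3
  have hanti : AntitoneOn g (Ici 1) := by
    intro x _ y _ hxy
    rw [hg, hg]
    exact mul_le_mul_of_nonneg_left (max_le_max (by linarith) le_rfl) hc.le
  have hnn : ∀ x : ℝ, 1 ≤ x → 0 ≤ g x := fun x _ => by
    rw [hg]; exact mul_nonneg hc.le (le_max_right _ _)
  have hg1 : g 1 = c * (a - 1) := by rw [hg, max_eq_left (by linarith)]
  have hcube : ∀ x : ℝ, 1 ≤ x → g 1 - g x ≤ (1 - g 1) / 3 * (x - 1) := by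
    intro x hx
    have key : (a - 1) - max (a - x) 0 ≤ x - 1 := by
      rcases le_total (a - x) 0 with h | h
      · rw [max_eq_right h]; linarith
      · rw [max_eq_left h]; linarith
    have h3 : (1 - g 1) / 3 = c := by rw [hg1]; linarith
    rw [h3, hg1, hg]
    nlinarith [mul_le_mul_of_nonneg_left key hc.le]
  obtain ⟨W, hsym, hhom, hsub, hmono, hsand, hfar, hone⟩ := farTail_realisable hconv hanti hnn hcube
  refine ⟨W, ⟨hsym, hhom, hsub, hmono, hsand⟩, ?_, ?_, ?_⟩
  · -- `FiniteSaturation`-shape at `K = ⌈a⌉₊`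
    refine ⟨⌈a⌉₊, ?_, ?_⟩
    · have h : (2 : ℝ) ≤ ⌈a⌉₊ := by
        have := Nat.le_ceil a
        have h2 : (1 : ℝ) < ⌈a⌉₊ := lt_of_lt_of_le ha this
        have h3 : (1 : ℕ) < ⌈a⌉₊ := by exact_mod_cast h2
        exact_mod_cast h3
      exact_mod_cast h
    · have hKa : a ≤ (⌈a⌉₊ : ℝ) := Nat.le_ceil a
      rw [hfar _ (by linarith), hg, max_eq_right (by linarith)]
      ring
  · -- `L(a)`-shape: `g = 0` on `[a, ∞)`
    intro m hm
    rw [hfar m (by linarith), hfar a ha.le, hfar (2 * m - a) (by linarith), hg m, hg a,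
      max_eq_right (by linarith : a - m ≤ 0), max_eq_right (by linarith : a - a ≤ 0)]
    simp
  · rw [hone, hg1]
    nlinarith

end Summit.MatrixMultiplication.MatrixMultiplication.Theorems.FarEdgeDescentAnchorLaw

end
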